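import Literature.NumberTheory.Sieve.PolynomialValuesSieveBounds
import Literature.NumberTheory.Sieve.JurkatRichertRefutation
import Mathlib.Analysis.PSeries
import HarnessLib

/-!
# Two linear forms: the arithmetic set-up of Diamond–Halberstam's Table 1 (`g = 2`)

Topic `Literature/NumberTheory/Sieve`. Set-up for the proof of
`Literature.NumberTheory.Sieve.DiamondHalberstam1997_twoLinear_P5` (Diamond–Halberstam, *Some
applications of sieves of dimension exceeding 1* (1997), special case 1 / Table 1, `g = 2`, `r = 5`
[DiamondHalberstam1997]): the sifted sequence is `{H(n) : 1 ≤ n ≤ N}` with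
`H = (a₁X + b₁)(a₂X + b₂)`, `aᵢ, bᵢ ≥ 1`, `a₁b₂ ≠ a₂b₁`, no fixed prime divisor, realised through the
tree's `polyAPSeq H N q r` (`PolynomialValuesSieveSequence.lean`) with density `rootDensity H = ω_H(m)/m`.
Everything is PROVED:

* `TwoLinear.poly`, `TwoLinear.val` and `TwoLinear.Admissible` (the standing hypotheses after the
  reduction to positive coefficients), `eval_poly`, `val_pos`, `val_le`;
* `rootCount_lt` (`ω_H(p) < p`, from "no fixed prime divisor"), `rootCount_le_two` (`ω_H(p) ≤ 2`:
  the roots of `H` mod `p` are roots of one of the two linear factors), `rootCount_two_le_one`;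
* `card_sq_dvd_val_le`: for a prime `p ∤ a₁ a₂ (a₁b₂ − a₂b₁)`,
  `#{n ≤ N : p² ∣ H(n)} ≤ 2 (N/p² + 1)` (`p²` divides one of the two factors, and `aᵢ` is a unit
  mod `p²`);
* `hasIwaniecDimension_rootDensity`: for ANY `f ∈ ℤ[X]` with `ω_f(2) ≤ 1` and `ω_f(p) ≤ 2`, the
  density `ω_f(m)/m` satisfies Iwaniec's `Ω(2, L)` with `L = 106 e^{106/log 2}`
  (`(1 − ω/p)⁻¹ ≤ (1 − 1/p)⁻² e^{3/p²}`, Mertens' product theorem with rate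
  `PairProducts.abs_log_mertensProd_sub_le`, and `∑_{p ≥ w} 3/p² ≤ 6/w`); this is the hypothesis of
  the tree's PROVED Rosser-sieve theorem `Iwaniec1980_thm1_lower/upper_local` (κ = 2).

## References

* H. Diamond, H. Halberstam, LMS LN 237 (1997), 101–107: special case 1, Table 1. [DiamondHalberstam1997]
* H. Halberstam, H.-E. Richert, *Sieve Methods* (1974), Ch. 1 (Examples 3, 5), Thm 10.5. [HalberstamRichert1974]
* G. H. Hardy, E. M. Wright, Thm 429 (Mertens' product). [HardyWright2008]
-/

open Finset Real Polynomial

noncomputable section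

namespace Literature.NumberTheory.Sieve

namespace TwoLinear

variable (a₁ b₁ a₂ b₂ : ℕ)

/-! ### The polynomial and its values -/

/-- `H = (a₁X + b₁)(a₂X + b₂) ∈ ℤ[X]`. [cite: DiamondHalberstam1997, special case 1] -/
def poly : ℤ[X] := (C (a₁ : ℤ) * X + C (b₁ : ℤ)) * (C (a₂ : ℤ) * X + C (b₂ : ℤ))

/-- `H(n) = (a₁n + b₁)(a₂n + b₂)` as a natural number. [cite: DiamondHalberstam1997, special case 1] -/
def val (n : ℕ) : ℕ := (a₁ * n + b₁) * (a₂ * n + b₂)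

/-- `H(n)` evaluated in `ℤ` is the natural number `val n`. [folklore] -/
theorem eval_poly (n : ℕ) : (poly a₁ b₁ a₂ b₂).eval (n : ℤ) = (val a₁ b₁ a₂ b₂ n : ℤ) := by
  simp [poly, val]

/-- `|H(n)| = val n`. [folklore] -/
theorem natAbs_eval_poly (n : ℕ) : ((poly a₁ b₁ a₂ b₂).eval (n : ℤ)).natAbs = val a₁ b₁ a₂ b₂ n := by
  rw [eval_poly, Int.natAbs_natCast]

/-- The standing hypotheses (after reduction to positive coefficients): `aᵢ, bᵢ ≥ 1`, the forms are
not proportional (`a₁b₂ ≠ a₂b₁`), and `H` has no fixed prime divisor.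
[cite: DiamondHalberstam1997, special case 1] -/
structure Admissible : Prop where
  /-- `a₁ ≥ 1`. -/
  ha₁ : 0 < a₁
  /-- `b₁ ≥ 1`. -/
  hb₁ : 0 < b₁
  /-- `a₂ ≥ 1`. -/
  ha₂ : 0 < a₂
  /-- `b₂ ≥ 1`. -/
  hb₂ : 0 < b₂
  /-- The two forms are not proportional. -/
  hne : a₁ * b₂ ≠ a₂ * b₁
  /-- No fixed prime divisor: for every prime `p` some value is not divisible by `p`. -/
  hfix : ∀ p : ℕ, p.Prime → ∃ n : ℕ, ¬ p ∣ val a₁ b₁ a₂ b₂ n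

variable {a₁ b₁ a₂ b₂}

/-- The values are positive (`bᵢ ≥ 1`). [folklore] -/
theorem val_pos (h : Admissible a₁ b₁ a₂ b₂) (n : ℕ) : 0 < val a₁ b₁ a₂ b₂ n := by
  unfold val
  have := h.hb₁; have := h.hb₂
  positivity

/-- `H(n) ≤ (a₁ + b₁)(a₂ + b₂) N²` for `1 ≤ n ≤ N`. [folklore] -/
theorem val_le {n N : ℕ} (hn1 : 1 ≤ n) (hnN : n ≤ N) :
    val a₁ b₁ a₂ b₂ n ≤ (a₁ + b₁) * (a₂ + b₂) * N ^ 2 := by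
  unfold val
  have h1 : a₁ * n + b₁ ≤ (a₁ + b₁) * N := by nlinarith
  have h2 : a₂ * n + b₂ ≤ (a₂ + b₂) * N := by nlinarith
  calc (a₁ * n + b₁) * (a₂ * n + b₂) ≤ ((a₁ + b₁) * N) * ((a₂ + b₂) * N) :=
        Nat.mul_le_mul h1 h2
    _ = (a₁ + b₁) * (a₂ + b₂) * N ^ 2 := by ring

/-- On the index set `(0, N]` the values satisfy `0 < H(n) ≤ x` for any `x ≥ (a₁+b₁)(a₂+b₂)N²`
(the shape of hypothesis consumed by `polyAPSeq_sifted` / `abs_remainder_polyAPSeq_le`). [folklore] -/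
theorem eval_pos_le (h : Admissible a₁ b₁ a₂ b₂) {N q r : ℕ} {x : ℝ}
    (hx : ((a₁ + b₁) * (a₂ + b₂) * N ^ 2 : ℕ) ≤ x) :
    ∀ n ∈ apIndex N q r, 0 < (poly a₁ b₁ a₂ b₂).eval (n : ℤ) ∧
      (((poly a₁ b₁ a₂ b₂).eval (n : ℤ) : ℤ) : ℝ) ≤ x := by
  intro n hn
  rw [mem_apIndex] at hn
  rw [eval_poly]
  refine ⟨by exact_mod_cast val_pos h n, ?_⟩
  have := val_le (a₁ := a₁) (b₁ := b₁) (a₂ := a₂) (b₂ := b₂) hn.1.1 hn.1.2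
  push_cast
  exact le_trans (by exact_mod_cast this) hx

/-! ### The root count `ω_H(p)` -/

/-- `ω_H(m) = #{s < m : m ∣ H(s)}` (the tree's `polyRootCountMod`, through `val`). [folklore] -/
theorem rootCount_eq (m : ℕ) :
    polyRootCountMod ![poly a₁ b₁ a₂ b₂] m = #((range m).filter fun s : ℕ => m ∣ val a₁ b₁ a₂ b₂ s) := by
  rw [← card_filter_dvd_eval_eq_polyRootCountMod]
  congr 1
  refine Finset.filter_congr fun s _ => ?_
  rw [eval_poly, Int.natCast_dvd_natCast]

/-- **`ω_H(p) < p`** for every prime `p`: the hypothesis "no fixed prime divisor" says that some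
residue is not a root. [cite: DiamondHalberstam1997, special case 1 ("`H(n)` has no fixed prime divisor")] -/
theorem rootCount_lt (h : Admissible a₁ b₁ a₂ b₂) {p : ℕ} (hp : p.Prime) :
    polyRootCountMod ![poly a₁ b₁ a₂ b₂] p < p := by
  obtain ⟨n, hn⟩ := h.hfix p hp
  rw [← card_filter_dvd_eval_eq_polyRootCountMod]
  have hsub : (range p).filter (fun s : ℕ => (p : ℤ) ∣ (poly a₁ b₁ a₂ b₂).eval (s : ℤ)) ⊆
      (range p).erase (n % p) := by
    intro s hs
    rw [Finset.mem_filter] at hs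
    rw [Finset.mem_erase]
    refine ⟨fun hse => hn ?_, hs.1⟩
    have : (p : ℤ) ∣ (poly a₁ b₁ a₂ b₂).eval (n : ℤ) := by
      rw [dvd_eval_iff_dvd_eval_mod, ← hse]; exact hs.2
    rw [eval_poly, Int.natCast_dvd_natCast] at this
    exact this
  calc #((range p).filter fun s : ℕ => (p : ℤ) ∣ (poly a₁ b₁ a₂ b₂).eval (s : ℤ))
      ≤ #((range p).erase (n % p)) := Finset.card_le_card hsub
    _ < p := by
        rw [Finset.card_erase_of_mem (Finset.mem_range.mpr (Nat.mod_lt n hp.pos)), Finset.card_range]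
        exact Nat.sub_lt hp.pos one_pos

/-- A linear congruence `a s + b ≡ 0 (mod p)`, `p` prime, has at most one solution `0 ≤ s < p`
unless `p ∣ a` and `p ∣ b`. [folklore] -/
theorem card_filter_linear_le_one {p a b : ℕ} (hp : p.Prime) (hab : ¬ (p ∣ a ∧ p ∣ b)) :
    #((range p).filter fun s : ℕ => p ∣ a * s + b) ≤ 1 := by
  by_cases hpa : p ∣ a
  · -- then no solution at all
    have : (range p).filter (fun s : ℕ => p ∣ a * s + b) = ∅ :=
      Finset.filter_false_of_mem fun s _ hs =>
        hab ⟨hpa, (Nat.dvd_add_right (dvd_mul_of_dvd_left hpa s)).mp hs⟩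
    rw [this]; simp
  · refine Finset.card_le_one.mpr fun s hs t ht => ?_
    rw [Finset.mem_filter, Finset.mem_range] at hs ht
    -- `p ∣ a (s - t)` in `ℤ`
    have h1 : (p : ℤ) ∣ (a : ℤ) * ((s : ℤ) - t) := by
      have hs' : (p : ℤ) ∣ (a * s + b : ℕ) := Int.natCast_dvd_natCast.mpr hs.2
      have ht' : (p : ℤ) ∣ (a * t + b : ℕ) := Int.natCast_dvd_natCast.mpr ht.2
      have := dvd_sub hs' ht'
      push_cast at this
      have e : (a : ℤ) * ((s : ℤ) - t) = (a : ℤ) * s + b - ((a : ℤ) * t + b) := by ring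
      rw [e]; exact this
    have hpz : Prime (p : ℤ) := Nat.prime_iff_prime_int.mp hp
    rcases hpz.dvd_or_dvd h1 with h2 | h2
    · exact absurd (Int.natCast_dvd_natCast.mp h2) hpa
    · have h3 : ((s : ℤ) - t).natAbs < p := by
        have hs1 := hs.1; have ht1 := ht.1
        omega
      have := Int.eq_zero_of_dvd_of_natAbs_lt_natAbs h2 (by simpa using h3)
      omega

/-- **`ω_H(p) ≤ 2`** for every prime `p`: a root of `H = (a₁X+b₁)(a₂X+b₂)` mod `p` is a root of one
of the linear factors, each of which has at most one root (a factor vanishing identically mod `p`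
would make `p` a fixed prime divisor). [cite: HalberstamRichert1974, Thm 10.5 (set-up)] -/
theorem rootCount_le_two (h : Admissible a₁ b₁ a₂ b₂) {p : ℕ} (hp : p.Prime) :
    polyRootCountMod ![poly a₁ b₁ a₂ b₂] p ≤ 2 := by
  rw [rootCount_eq]
  have hfix1 : ¬ (p ∣ a₁ ∧ p ∣ b₁) := by
    rintro ⟨hpa, hpb⟩
    obtain ⟨n, hn⟩ := h.hfix p hp
    exact hn (dvd_mul_of_dvd_left (dvd_add (dvd_mul_of_dvd_left hpa n) hpb) _)
  have hfix2 : ¬ (p ∣ a₂ ∧ p ∣ b₂) := by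
    rintro ⟨hpa, hpb⟩
    obtain ⟨n, hn⟩ := h.hfix p hp
    exact hn (dvd_mul_of_dvd_right (dvd_add (dvd_mul_of_dvd_left hpa n) hpb) _)
  have hsub : (range p).filter (fun s : ℕ => p ∣ val a₁ b₁ a₂ b₂ s) ⊆
      (range p).filter (fun s : ℕ => p ∣ a₁ * s + b₁) ∪ (range p).filter (fun s : ℕ => p ∣ a₂ * s + b₂) := by
    intro s hs
    rw [Finset.mem_filter] at hs
    rw [Finset.mem_union, Finset.mem_filter, Finset.mem_filter]
    rcases hp.dvd_mul.mp hs.2 with h1 | h1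
    · exact Or.inl ⟨hs.1, h1⟩
    · exact Or.inr ⟨hs.1, h1⟩
  calc #((range p).filter fun s : ℕ => p ∣ val a₁ b₁ a₂ b₂ s)
      ≤ #((range p).filter (fun s : ℕ => p ∣ a₁ * s + b₁) ∪
          (range p).filter (fun s : ℕ => p ∣ a₂ * s + b₂)) := Finset.card_le_card hsub
    _ ≤ #((range p).filter fun s : ℕ => p ∣ a₁ * s + b₁) +
          #((range p).filter fun s : ℕ => p ∣ a₂ * s + b₂) := Finset.card_union_le _ _
    _ ≤ 1 + 1 := add_le_add (card_filter_linear_le_one hp hfix1) (card_filter_linear_le_one hp hfix2)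

/-- `ω_H(2) ≤ 1`. [folklore] -/
theorem rootCount_two_le_one (h : Admissible a₁ b₁ a₂ b₂) : polyRootCountMod ![poly a₁ b₁ a₂ b₂] 2 ≤ 1 :=
  Nat.lt_succ_iff.mp (rootCount_lt h Nat.prime_two)

/-! ### Values divisible by the square of a large prime -/

/-- In `(0, N]`, a congruence `a n + b ≡ 0 (mod m)` with `(a, m) = 1`, `m ≥ 1`, has at most `N/m + 1`
solutions (they lie in one residue class mod `m`). [folklore] -/
theorem card_Ioc_filter_dvd_linear_le {m a b : ℕ} (hm : 0 < m) (ham : a.Coprime m) (N : ℕ) :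
    (#((Ioc 0 N).filter fun n : ℕ => m ∣ a * n + b) : ℝ) ≤ N / m + 1 := by
  by_cases hex : ∃ n₀, m ∣ a * n₀ + b
  · obtain ⟨n₀, hn₀⟩ := hex
    have hsub : (Ioc 0 N).filter (fun n : ℕ => m ∣ a * n + b) ⊆
        (Ioc 0 N).filter (fun n : ℕ => n ≡ n₀ [MOD m]) := by
      intro n hn
      rw [Finset.mem_filter] at hn ⊢
      refine ⟨hn.1, ?_⟩
      -- `m ∣ a (n - n₀)` in `ℤ`, and `a` is a unit mod `m`
      have h1 : (m : ℤ) ∣ (a : ℤ) * ((n : ℤ) - n₀) := by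
        have hA : (m : ℤ) ∣ (a * n + b : ℕ) := Int.natCast_dvd_natCast.mpr hn.2
        have hB : (m : ℤ) ∣ (a * n₀ + b : ℕ) := Int.natCast_dvd_natCast.mpr hn₀
        have := dvd_sub hA hB
        push_cast at this
        have e : (a : ℤ) * ((n : ℤ) - n₀) = (a : ℤ) * n + b - ((a : ℤ) * n₀ + b) := by ring
        rw [e]; exact this
      have h2 : (m : ℤ) ∣ (n : ℤ) - n₀ :=
        Int.dvd_of_dvd_mul_right_of_gcd_one h1 (by
          rw [Int.gcd_natCast_natCast]; exact ham.symm)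
      have h3 : (m : ℤ) ∣ (n₀ : ℤ) - n := by
        rw [← neg_sub]; exact (dvd_neg).mpr h2
      exact Nat.modEq_iff_dvd.mpr h3
    calc (#((Ioc 0 N).filter fun n : ℕ => m ∣ a * n + b) : ℝ)
        ≤ #((Ioc 0 N).filter fun n : ℕ => n ≡ n₀ [MOD m]) := by exact_mod_cast Finset.card_le_card hsub
      _ ≤ N / m + 1 := by
          have := (abs_le.mp (abs_card_Ioc_filter_modEq_sub_le hm N n₀)).2
          linarith
  · push Not at hex
    have : (Ioc 0 N).filter (fun n : ℕ => m ∣ a * n + b) = ∅ :=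
      Finset.filter_false_of_mem fun n _ => hex n
    rw [this, Finset.card_empty, Nat.cast_zero]
    have : (0 : ℝ) ≤ N / m := by positivity
    linarith

/-- **Values divisible by `p²`**: if the prime `p` divides neither `a₁`, `a₂` nor
`a₁b₂ − a₂b₁` (as an integer), then `#{1 ≤ n ≤ N : p² ∣ H(n)} ≤ 2(N/p² + 1)`: `p` cannot divide
both factors (else `p ∣ a₂(a₁n+b₁) − a₁(a₂n+b₂) = a₂b₁ − a₁b₂`), so `p²` divides one of them.
[cite: HalberstamRichert1974, Thm 10.5 (set-up)] -/
theorem card_sq_dvd_val_le {p : ℕ} (hp : p.Prime) (hpa₁ : ¬ p ∣ a₁) (hpa₂ : ¬ p ∣ a₂)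
    (hpΔ : ¬ (p : ℤ) ∣ (a₁ : ℤ) * b₂ - a₂ * b₁) (N : ℕ) :
    (#((Ioc 0 N).filter fun n : ℕ => p ^ 2 ∣ val a₁ b₁ a₂ b₂ n) : ℝ) ≤ 2 * (N / p ^ 2 + 1) := by
  have hp2 : 0 < p ^ 2 := pow_pos hp.pos 2
  have hsub : (Ioc 0 N).filter (fun n : ℕ => p ^ 2 ∣ val a₁ b₁ a₂ b₂ n) ⊆
      (Ioc 0 N).filter (fun n : ℕ => p ^ 2 ∣ a₁ * n + b₁) ∪
        (Ioc 0 N).filter (fun n : ℕ => p ^ 2 ∣ a₂ * n + b₂) := by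
    intro n hn
    rw [Finset.mem_filter] at hn
    rw [Finset.mem_union, Finset.mem_filter, Finset.mem_filter]
    obtain ⟨hnI, hdvd⟩ := hn
    unfold val at hdvd
    -- `p` does not divide both factors
    have hnot : ¬ (p ∣ a₁ * n + b₁ ∧ p ∣ a₂ * n + b₂) := by
      rintro ⟨h1, h2⟩
      apply hpΔ
      have h1' : (p : ℤ) ∣ (a₁ * n + b₁ : ℕ) := Int.natCast_dvd_natCast.mpr h1
      have h2' : (p : ℤ) ∣ (a₂ * n + b₂ : ℕ) := Int.natCast_dvd_natCast.mpr h2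
      have := dvd_sub (dvd_mul_of_dvd_right h2' (a₁ : ℤ)) (dvd_mul_of_dvd_right h1' (a₂ : ℤ))
      push_cast at this
      have e : (a₁ : ℤ) * b₂ - a₂ * b₁ = (a₁ : ℤ) * ((a₂ : ℤ) * n + b₂) - (a₂ : ℤ) * ((a₁ : ℤ) * n + b₁) := by
        ring
      rw [e]; exact this
    by_cases h1 : p ∣ a₁ * n + b₁
    · have h2 : ¬ p ∣ a₂ * n + b₂ := fun h2 => hnot ⟨h1, h2⟩
      have hcop : (p ^ 2).Coprime (a₂ * n + b₂) :=
        (Nat.Coprime.pow_left 2 ((Nat.Prime.coprime_iff_not_dvd hp).mpr h2))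
      exact Or.inl ⟨hnI, hcop.dvd_of_dvd_mul_right hdvd⟩
    · have hcop : (p ^ 2).Coprime (a₁ * n + b₁) :=
        (Nat.Coprime.pow_left 2 ((Nat.Prime.coprime_iff_not_dvd hp).mpr h1))
      exact Or.inr ⟨hnI, hcop.dvd_of_dvd_mul_left hdvd⟩
  have hc₁ : a₁.Coprime (p ^ 2) :=
    Nat.Coprime.pow_right 2 ((Nat.Prime.coprime_iff_not_dvd hp).mpr hpa₁).symm
  have hc₂ : a₂.Coprime (p ^ 2) :=
    Nat.Coprime.pow_right 2 ((Nat.Prime.coprime_iff_not_dvd hp).mpr hpa₂).symm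
  have hb₁ := card_Ioc_filter_dvd_linear_le (b := b₁) hp2 hc₁ N
  have hb₂ := card_Ioc_filter_dvd_linear_le (b := b₂) hp2 hc₂ N
  push_cast at hb₁ hb₂
  calc (#((Ioc 0 N).filter fun n : ℕ => p ^ 2 ∣ val a₁ b₁ a₂ b₂ n) : ℝ)
      ≤ #((Ioc 0 N).filter (fun n : ℕ => p ^ 2 ∣ a₁ * n + b₁) ∪
          (Ioc 0 N).filter (fun n : ℕ => p ^ 2 ∣ a₂ * n + b₂)) := by
        exact_mod_cast Finset.card_le_card hsub
    _ ≤ #((Ioc 0 N).filter fun n : ℕ => p ^ 2 ∣ a₁ * n + b₁) +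
          #((Ioc 0 N).filter fun n : ℕ => p ^ 2 ∣ a₂ * n + b₂) := by
        exact_mod_cast Finset.card_union_le _ _
    _ ≤ (N / p ^ 2 + 1) + (N / p ^ 2 + 1) := add_le_add hb₁ hb₂
    _ = 2 * (N / p ^ 2 + 1) := by ring

end TwoLinear

/-! ### Iwaniec's dimension condition `Ω(2, L)` for `ω_f(m)/m` -/

/-- Termwise comparison with the Mertens factor: if `ω(2) ≤ 1` and `ω(p) ≤ 2`, then for every prime
`p`, `(1 − ω(p)/p)⁻¹ ≤ (1 − 1/p)⁻² e^{3/p²}` (for `p ≥ 3`: `p/(p−2) ≤ (p/(p−1))² (1 + 3/p²)`).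
[folklore] -/
theorem inv_one_sub_rootDensity_le {f : ℤ[X]} (h2 : polyRootCountMod ![f] 2 ≤ 1)
    (hle : ∀ p : ℕ, p.Prime → polyRootCountMod ![f] p ≤ 2) {p : ℕ} (hp : p.Prime) :
    (1 - rootDensity f p)⁻¹ ≤ ((1 - (p : ℝ)⁻¹)⁻¹) ^ 2 * Real.exp (3 / (p : ℝ) ^ 2) := by
  have hp2 : (2 : ℝ) ≤ p := by exact_mod_cast hp.two_le
  have hp0 : (0 : ℝ) < p := by linarith
  have hexp : 1 + 3 / (p : ℝ) ^ 2 ≤ Real.exp (3 / (p : ℝ) ^ 2) := by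
    have := Real.add_one_le_exp (3 / (p : ℝ) ^ 2); linarith
  have hM : ((1 - (p : ℝ)⁻¹)⁻¹) ^ 2 = (p : ℝ) ^ 2 / ((p : ℝ) - 1) ^ 2 := by
    have : (p : ℝ) - 1 ≠ 0 := by linarith
    field_simp
  rw [rootDensity_apply, hM]
  rcases hp.eq_two_or_odd' with rfl | hodd
  · have hc1 : (polyRootCountMod ![f] 2 : ℝ) ≤ 1 := by exact_mod_cast h2
    push_cast
    calc (1 - (polyRootCountMod ![f] 2 : ℝ) / 2)⁻¹ ≤ (1 - 1 / 2)⁻¹ := by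
          apply inv_anti₀ (by norm_num); linarith
      _ ≤ (2 : ℝ) ^ 2 / (2 - 1) ^ 2 * 1 := by norm_num
      _ ≤ (2 : ℝ) ^ 2 / (2 - 1) ^ 2 * Real.exp (3 / (2 : ℝ) ^ 2) := by
          gcongr; linarith [hexp]
  · have hp3 : 3 ≤ p := by
      have := hp.two_le; rcases hodd with ⟨k, hk⟩; omega
    have hp3' : (3 : ℝ) ≤ p := by exact_mod_cast hp3
    have hc : (polyRootCountMod ![f] p : ℝ) / p ≤ 2 / p :=
      div_le_div_of_nonneg_right (by exact_mod_cast hle p hp) hp0.le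
    have h23 : 2 / (p : ℝ) ≤ 2 / 3 := div_le_div_of_nonneg_left (by norm_num) (by norm_num) hp3'
    calc (1 - (polyRootCountMod ![f] p : ℝ) / p)⁻¹ ≤ (1 - 2 / (p : ℝ))⁻¹ :=
          inv_anti₀ (by linarith) (by linarith)
      _ = p / ((p : ℝ) - 2) := by
          have : (p : ℝ) - 2 ≠ 0 := by linarith
          field_simp
      _ ≤ (p : ℝ) ^ 2 / ((p : ℝ) - 1) ^ 2 * (1 + 3 / (p : ℝ) ^ 2) := by
          rw [div_le_iff₀ (by linarith)]
          have e : (p : ℝ) ^ 2 / ((p : ℝ) - 1) ^ 2 * (1 + 3 / (p : ℝ) ^ 2) * ((p : ℝ) - 2) =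
              ((p : ℝ) ^ 2 + 3) * ((p : ℝ) - 2) / ((p : ℝ) - 1) ^ 2 := by
            field_simp
          have hq : (0 : ℝ) < ((p : ℝ) - 1) ^ 2 := by
            have : (0 : ℝ) < (p : ℝ) - 1 := by linarith
            positivity
          rw [e, le_div_iff₀ hq]
          nlinarith
      _ ≤ (p : ℝ) ^ 2 / ((p : ℝ) - 1) ^ 2 * Real.exp (3 / (p : ℝ) ^ 2) := by gcongr

/-- The tail of `∑ 1/p²` over a window of primes: `∑_{w ≤ p < z} 1/p² ≤ 2/w` for `w ≥ 2`
(`Finset.sum_Ioo_inv_sq_le`). [folklore] -/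
theorem sum_window_inv_sq_le {w z : ℝ} (hw : 2 ≤ w) :
    ∑ p ∈ (Nat.primesBelow ⌈z⌉₊).filter (fun p : ℕ => w ≤ (p : ℝ)), 1 / (p : ℝ) ^ 2 ≤ 2 / w := by
  set k := ⌈w⌉₊ - 1 with hk
  have hwc : 2 ≤ ⌈w⌉₊ := by
    have h := Nat.le_ceil w
    exact_mod_cast hw.trans h
  have hk1 : (k : ℝ) + 1 = ⌈w⌉₊ := by
    rw [hk]; push_cast [Nat.cast_sub (by omega : 1 ≤ ⌈w⌉₊)]; ring
  have hsub : (Nat.primesBelow ⌈z⌉₊).filter (fun p : ℕ => w ≤ (p : ℝ)) ⊆ Ioo k ⌈z⌉₊ := by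
    intro p hp
    rw [Finset.mem_filter, Nat.mem_primesBelow] at hp
    rw [Finset.mem_Ioo]
    refine ⟨?_, hp.1.1⟩
    have : ⌈w⌉₊ ≤ p := Nat.ceil_le.mpr hp.2
    omega
  calc ∑ p ∈ (Nat.primesBelow ⌈z⌉₊).filter (fun p : ℕ => w ≤ (p : ℝ)), 1 / (p : ℝ) ^ 2
      ≤ ∑ i ∈ Ioo k ⌈z⌉₊, ((i : ℝ) ^ 2)⁻¹ := by
        simp_rw [one_div]
        exact Finset.sum_le_sum_of_subset_of_nonneg hsub fun i _ _ => by positivity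
    _ ≤ 2 / ((k : ℝ) + 1) := sum_Ioo_inv_sq_le k ⌈z⌉₊
    _ = 2 / ⌈w⌉₊ := by rw [hk1]
    _ ≤ 2 / w := div_le_div_of_nonneg_left (by norm_num) (by linarith) (Nat.le_ceil w)

/-- **The root-count density satisfies Iwaniec's `Ω(2, L)`** with `L = 106 e^{106/log 2}`: if
`ω_f(2) ≤ 1` and `ω_f(p) ≤ 2` for all primes `p`, then `0 ≤ ω_f(p)/p < 1` and for `2 ≤ w ≤ z`
`∏_{w ≤ p < z} (1 − ω_f(p)/p)⁻¹ ≤ (Π(z)/Π(w))² e^{6/w} ≤ (log z/log w)² e^{106/log w}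
≤ (log z/log w)² (1 + L/log w)` (Mertens' product theorem with rate). [cite: HardyWright2008, Thm 429 (§22.8)] -/
theorem hasIwaniecDimension_rootDensity {f : ℤ[X]} (h2 : polyRootCountMod ![f] 2 ≤ 1)
    (hle : ∀ p : ℕ, p.Prime → polyRootCountMod ![f] p ≤ 2) :
    HasIwaniecDimension (rootDensity f) 2 (106 * Real.exp (106 / Real.log 2)) := by
  refine ⟨fun p hp => rootDensity_lt_one h2 hle hp, fun w z hw hwz => ?_⟩
  set S := (Nat.primesBelow ⌈z⌉₊).filter (fun p : ℕ => w ≤ (p : ℝ)) with hS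
  have hlogw : 0 < Real.log w := Real.log_pos (by linarith)
  have hlogz : 0 < Real.log z := Real.log_pos (by linarith)
  have hlog2w : Real.log 2 ≤ Real.log w := Real.log_le_log two_pos hw
  have hlog2 : 0 < Real.log 2 := Real.log_pos one_lt_two
  -- termwise bound and the product
  have hnonneg : ∀ p ∈ S, 0 ≤ (1 - rootDensity f p)⁻¹ := fun p hp =>
    inv_nonneg.mpr (sub_nonneg.mpr (rootDensity_lt_one h2 hle
      (Nat.prime_of_mem_primesBelow (Finset.mem_filter.mp hp).1)).2.le)
  have hpt : ∀ p ∈ S, (1 - rootDensity f p)⁻¹ ≤ ((1 - (p : ℝ)⁻¹)⁻¹) ^ 2 * Real.exp (3 / (p : ℝ) ^ 2) :=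
    fun p hp => inv_one_sub_rootDensity_le h2 hle (Nat.prime_of_mem_primesBelow (Finset.mem_filter.mp hp).1)
  have hprod : ∏ p ∈ S, (1 - rootDensity f p)⁻¹ ≤
      (PairProducts.mertensProd z / PairProducts.mertensProd w) ^ 2 *
        Real.exp (3 * ∑ p ∈ S, 1 / (p : ℝ) ^ 2) := by
    calc ∏ p ∈ S, (1 - rootDensity f p)⁻¹
        ≤ ∏ p ∈ S, (((1 - (p : ℝ)⁻¹)⁻¹) ^ 2 * Real.exp (3 / (p : ℝ) ^ 2)) := Finset.prod_le_prod hnonneg hpt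
      _ = (∏ p ∈ S, (1 - (p : ℝ)⁻¹)⁻¹) ^ 2 * Real.exp (3 * ∑ p ∈ S, 1 / (p : ℝ) ^ 2) := by
          rw [Finset.prod_mul_distrib, Finset.prod_pow, ← Real.exp_sum, Finset.mul_sum]
          congr 2
          refine Finset.sum_congr rfl fun p _ => ?_
          ring
      _ = (PairProducts.mertensProd z / PairProducts.mertensProd w) ^ 2 *
            Real.exp (3 * ∑ p ∈ S, 1 / (p : ℝ) ^ 2) := by
          rw [hS, PairProducts.prod_filter_eq_mertensProd_div hwz]
  -- Mertens with rate: `(Π(z)/Π(w))² ≤ (log z/log w)² e^{100/log w}`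
  set R := PairProducts.mertensProd z / PairProducts.mertensProd w with hR
  have hRpos : 0 < R := div_pos (PairProducts.mertensProd_pos z) (PairProducts.mertensProd_pos w)
  obtain ⟨-, hz2⟩ := abs_le.mp (PairProducts.abs_log_mertensProd_sub_le (le_trans hw hwz))
  obtain ⟨hw1, -⟩ := abs_le.mp (PairProducts.abs_log_mertensProd_sub_le hw)
  have hlogR : Real.log R ≤ Real.log (Real.log z) - Real.log (Real.log w) + 50 / Real.log w := by
    rw [hR, Real.log_div (PairProducts.mertensProd_pos z).ne' (PairProducts.mertensProd_pos w).ne']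
    have : 25 / Real.log z ≤ 25 / Real.log w :=
      div_le_div_of_nonneg_left (by norm_num) hlogw (Real.log_le_log (by linarith) hwz)
    have e50 : (50 : ℝ) / Real.log w = 2 * (25 / Real.log w) := by ring
    linarith
  have hR2 : R ^ 2 ≤ (Real.log z / Real.log w) ^ (2 : ℝ) * Real.exp (100 / Real.log w) := by
    have e1 : R ^ 2 = Real.exp (2 * Real.log R) := by
      have : Real.log (R ^ 2) = 2 * Real.log R := by rw [Real.log_pow]; norm_num
      rw [← this, Real.exp_log (pow_pos hRpos 2)]
    have e2 : (Real.log z / Real.log w) ^ (2 : ℝ) * Real.exp (100 / Real.log w) =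
        Real.exp (2 * (Real.log (Real.log z) - Real.log (Real.log w)) + 100 / Real.log w) := by
      rw [Real.exp_add, show 2 * (Real.log (Real.log z) - Real.log (Real.log w)) =
        (Real.log (Real.log z) - Real.log (Real.log w)) + (Real.log (Real.log z) - Real.log (Real.log w))
        by ring, Real.exp_add, Real.exp_sub, Real.exp_log hlogz, Real.exp_log hlogw, Real.rpow_two]
      ring
    rw [e1, e2, Real.exp_le_exp]
    have e100 : (100 : ℝ) / Real.log w = 2 * (50 / Real.log w) := by ring
    linarith
  -- the `1/p²` tail: `3 ∑ ≤ 6/w ≤ 6/log w`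
  have htail : 3 * ∑ p ∈ S, 1 / (p : ℝ) ^ 2 ≤ 6 / Real.log w := by
    have h1 := sum_window_inv_sq_le (z := z) hw
    rw [← hS] at h1
    have hlw : Real.log w ≤ w := by
      linarith [Real.log_le_sub_one_of_pos (by linarith : (0:ℝ) < w)]
    calc 3 * ∑ p ∈ S, 1 / (p : ℝ) ^ 2 ≤ 3 * (2 / w) := by gcongr
      _ = 6 / w := by ring
      _ ≤ 6 / Real.log w := div_le_div_of_nonneg_left (by norm_num) hlogw hlw
  set t := 106 / Real.log w with ht_def
  have ht0 : 0 ≤ t := by positivity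
  have htle : t ≤ 106 / Real.log 2 := div_le_div_of_nonneg_left (by norm_num) hlog2 hlog2w
  calc ∏ p ∈ S, (1 - rootDensity f p)⁻¹
      ≤ R ^ 2 * Real.exp (3 * ∑ p ∈ S, 1 / (p : ℝ) ^ 2) := hprod
    _ ≤ ((Real.log z / Real.log w) ^ (2 : ℝ) * Real.exp (100 / Real.log w)) * Real.exp (6 / Real.log w) := by
        gcongr
    _ = (Real.log z / Real.log w) ^ (2 : ℝ) * Real.exp t := by
        rw [mul_assoc, ← Real.exp_add, ht_def]; congr 2; ring
    _ ≤ (Real.log z / Real.log w) ^ (2 : ℝ) * (1 + t * Real.exp (106 / Real.log 2)) := by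
        gcongr
        calc Real.exp t ≤ 1 + t * Real.exp t := PairProducts.exp_le_one_add_mul_exp t
          _ ≤ 1 + t * Real.exp (106 / Real.log 2) := by gcongr
    _ = (Real.log z / Real.log w) ^ (2 : ℝ) * (1 + 106 * Real.exp (106 / Real.log 2) / Real.log w) := by
        rw [ht_def]; ring

/-- **`V(z) ≫ 1/log² z` under `Ω(2, L)`**: for `z ≥ 2`,
`∏_{p<z} (1 − ω_f(p)/p) ≥ (log 2)² / ((1 + L/log 2) (log z)²)`, `L = 106 e^{106/log 2}`
(the case `w = 2` of the dimension condition). [folklore] -/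
theorem prod_one_sub_rootCount_ge {f : ℤ[X]} (h2 : polyRootCountMod ![f] 2 ≤ 1)
    (hle : ∀ p : ℕ, p.Prime → polyRootCountMod ![f] p ≤ 2) {z : ℝ} (hz : 2 ≤ z) :
    Real.log 2 ^ 2 / ((1 + 106 * Real.exp (106 / Real.log 2) / Real.log 2) * Real.log z ^ 2) ≤
      ∏ p ∈ Nat.primesBelow ⌈z⌉₊, (1 - (polyRootCountMod ![f] p : ℝ) / p) := by
  have hdim := hasIwaniecDimension_rootDensity h2 hle
  have hV := prod_one_sub_rootCount_pos h2 hle z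
  have hlog2 : 0 < Real.log 2 := Real.log_pos one_lt_two
  have hlogz : 0 < Real.log z := Real.log_pos (by linarith)
  have hL : 0 < 1 + 106 * Real.exp (106 / Real.log 2) / Real.log 2 := by positivity
  have h := hdim.2 2 z le_rfl hz
  rw [Finset.filter_true_of_mem fun p hp => by
    exact_mod_cast (Nat.prime_of_mem_primesBelow hp).two_le] at h
  simp only [rootDensity_apply] at h
  rw [Finset.prod_inv_distrib, Real.rpow_two] at h
  -- `h : V⁻¹ ≤ (log z/log 2)² (1 + L/log 2)`
  rw [div_le_iff₀ (by positivity)]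
  have h' := mul_le_mul_of_nonneg_left h hV.le
  rw [mul_inv_cancel₀ hV.ne'] at h'
  calc Real.log 2 ^ 2 = 1 * Real.log 2 ^ 2 := by ring
    _ ≤ ((∏ p ∈ Nat.primesBelow ⌈z⌉₊, (1 - (polyRootCountMod ![f] p : ℝ) / p)) *
          ((Real.log z / Real.log 2) ^ 2 * (1 + 106 * Real.exp (106 / Real.log 2) / Real.log 2))) *
          Real.log 2 ^ 2 := by gcongr
    _ = (∏ p ∈ Nat.primesBelow ⌈z⌉₊, (1 - (polyRootCountMod ![f] p : ℝ) / p)) *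
          ((1 + 106 * Real.exp (106 / Real.log 2) / Real.log 2) * Real.log z ^ 2) := by
        field_simp

end Literature.NumberTheory.Sieve

end
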